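import Literature.MathematicalPhysics.QuantumLattice.GrassmannEffectiveActionBiGradedDB
import Literature.MathematicalPhysics.QuantumLattice.GrassmannEffectiveActionGradedDB
import HarnessLib

/-!
# The bi-graded single-scale step in `kernelNorm` form and read through an analysis map

Topic `MathematicalPhysics/QuantumLattice`; the bi-graded twins (`GrassmannEffectiveActionBiGradedDB`:
`Σ_{W : W_i = w} ‖kernel_{2p}(effAction C V)(W)‖ ≤ ρ^{-2p}·e f₂·θ₂^{p-2}/(1-θ)^p`) of the two corollaries of
`GrassmannEffectiveActionGradedDB` (`kernelNorm_kernel_effAction_le_pow_of_gramBounded_quartic`,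
`kernelNorm_kernel_map_effAction_le_pow_of_gramBounded_quartic`):

* `kernelNorm_kernel_effAction_le_biquartic_of_gramBounded` — `‖kernel_{2p}(effAction C V)‖_1 ≤ ρ^{-2p}·e f₂·θ₂^{p-2}/(1-θ)^p`;
* **`kernelNorm_kernel_map_effAction_le_biquartic_of_gramBounded`** — with `V = map f Ṽ` and an analysis map `g` (row/column
  sums `cr`, `cc` of `E M`): `‖kernel (map g (effAction C V)) (2p)‖_ε ≤ cr·cc^{2p-1}·ε^{2p-1}·ρ^{-2p}·e f₂·θ₂^{p-2}/(1-θ)^p` —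
  the `2p`-point kernels carry `p - 1` powers of the QUARTIC pinned norm `N(2)` (`f₂ = (e²(κ+ρ))⁴N(2)`, `θ₂ = eαf₂/κ²`) however
  large the quadratic part of `Ṽ` (below the radius `θ < 1`).

## Sources

G. Benfatto, A. Giuliani, V. Mastropietro, Ann. Henri Poincaré 7 (2006) 809–898, (2.13)–(2.14), (2.71a), (2.77)–(2.82)
[`BenfattoGiulianiMastropietro2006`].
-/

noncomputable section

namespace Literature.MathematicalPhysics.QuantumLattice

open GrassmannAlgebra Finset Literature.Probability.LatticeModels
open scoped InnerProductSpace Nat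

universe u

variable {𝕜 : Type*} [RCLike 𝕜] {Γ : Type u} [Fintype Γ] [DecidableEq Γ] (C : Matrix Γ Γ 𝕜)

/-- `kernelNorm 1` from pinned bounds in any positive degree. [folklore] -/
private theorem kernelNorm_one_le_of_forall_pinned' {m : ℕ} (hm : 0 < m) (K : (Fin m → Γ) → 𝕜) {B : ℝ} (hB : 0 ≤ B)
    (h : ∀ (i : Fin m) (w : Γ), ∑ W ∈ univ.filter (fun W : Fin m → Γ => W i = w), ‖K W‖ ≤ B) :
    kernelNorm 1 m K ≤ B := by
  obtain ⟨q, rfl⟩ : ∃ q, m = q + 1 := ⟨m - 1, by omega⟩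
  exact kernelNorm_succ_le_of_forall 1 q K hB fun p x => by
    rw [one_pow, one_mul]
    exact h p x

/-- **The bi-graded step in `kernelNorm 1` form**: `‖kernel_{2p}(effAction C V)‖_1 ≤ ρ^{-2p}·e f₂·θ₂^{p-2}/(1-θ)^p`, `p ≥ 2`.
[cite: BenfattoGiulianiMastropietro2006, (2.13)-(2.14) and (2.77)-(2.80)] -/
theorem kernelNorm_kernel_effAction_le_biquartic_of_gramBounded {κ : ℝ} (hκ : 0 < κ) (hGB : IsGramBoundedR C κ)
    (V : GrassmannAlgebra 𝕜 Γ) (hV : V ∈ evenPart 𝕜 Γ) (hV0 : constPart 𝕜 V = 0) (N : ℕ → ℝ) (hN0 : ∀ m', 0 ≤ N m')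
    (hN : ∀ m' (j : Fin (2 * m')) (w : Γ), ∑ Y ∈ univ.filter (fun Y : Fin (2 * m') → Γ => Y j = w), ‖kernel 𝕜 V (2 * m') Y‖ ≤ N m')
    (hN2 : ∀ m', 2 < m' → N m' = 0)
    {α : ℝ} (hα : 0 < α) (hrow : ∀ X, ∑ Y, ‖C X Y‖ ≤ α) (hcol : ∀ Y, ∑ X, ‖C X Y‖ ≤ α) {ρ : ℝ} (hρ : 0 < ρ)
    (hθ : Real.exp 1 * α * normV Γ κ ρ N / κ ^ 2 < 1) {p : ℕ} (hp : 2 ≤ p) :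
    kernelNorm 1 (2 * p) (kernel 𝕜 (effAction 𝕜 C V) (2 * p)) ≤
      ρ⁻¹ ^ (2 * p) * (Real.exp 1 * ((Real.exp 2 * (κ + ρ)) ^ (2 * 2) * N 2)) *
        (Real.exp 1 * α * ((Real.exp 2 * (κ + ρ)) ^ (2 * 2) * N 2) / κ ^ 2) ^ (p - 2) /
          (1 - Real.exp 1 * α * normV Γ κ ρ N / κ ^ 2) ^ p := by
  have h2 : 0 ≤ N 2 := hN0 2
  refine kernelNorm_one_le_of_forall_pinned' (by omega) _ (div_nonneg (by positivity) (pow_nonneg (sub_nonneg.2 hθ.le) _))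
    fun i w => ?_
  exact (sum_norm_kernel_effAction_le_biquartic_of_gramBounded C hκ hGB V hV hV0 N hN0 hN hN2 hα hrow hcol hρ hθ hp i w).2

variable {Γ' Γ'' : Type u} [Fintype Γ'] [DecidableEq Γ'] [Fintype Γ''] [DecidableEq Γ'']

/-- **The bi-graded step read in another representation of the fields** (twin of
`kernelNorm_kernel_map_effAction_le_pow_of_gramBounded_quartic`): `V = map f Ṽ`, `Ṽ` even without constant part with pinned
norms `N(m')` vanishing for `m' > 2`, pulled-back covariance `Mᵀ C M` replica-Gram-bounded (`κ`) with row/column sums `≤ α`,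
`θ = eα‖Ṽ‖_h/κ² < 1`, analysis map `g` with `Σ_{X'} ‖(E M)(X'', X')‖ ≤ cr`, `Σ_{X''} ‖(E M)(X'', X')‖ ≤ cc`; then for `p ≥ 2`,
`ε ≥ 0`: `‖kernel (map g (effAction C V)) (2p)‖_ε ≤ cr·cc^{2p-1}·ε^{2p-1}·(ρ^{-2p}·e f₂·θ₂^{p-2}/(1-θ)^p)`.
[cite: BenfattoGiulianiMastropietro2006, (2.77) with (2.71a) and (2.80)-(2.82)] -/
theorem kernelNorm_kernel_map_effAction_le_biquartic_of_gramBounded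
    (C : Matrix Γ Γ 𝕜) (f : (Γ' → 𝕜) →ₗ[𝕜] (Γ → 𝕜)) (g : (Γ → 𝕜) →ₗ[𝕜] (Γ'' → 𝕜))
    (Vt : GrassmannAlgebra 𝕜 Γ') (hVt : Vt ∈ evenPart 𝕜 Γ') (hVt0 : constPart 𝕜 Vt = 0) (N : ℕ → ℝ) (hN0 : ∀ m', 0 ≤ N m')
    (hN : ∀ m' (j : Fin (2 * m')) (w : Γ'), ∑ Y ∈ univ.filter (fun Y : Fin (2 * m') → Γ' => Y j = w), ‖kernel 𝕜 Vt (2 * m') Y‖ ≤ N m')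
    (hN2 : ∀ m', 2 < m' → N m' = 0)
    {κ : ℝ} (hκ : 0 < κ) (hGB : IsGramBoundedR ((LinearMap.toMatrix' f).transpose * C * LinearMap.toMatrix' f) κ)
    {α : ℝ} (hα : 0 < α)
    (hrow : ∀ X, ∑ Y, ‖((LinearMap.toMatrix' f).transpose * C * LinearMap.toMatrix' f) X Y‖ ≤ α)
    (hcol : ∀ Y, ∑ X, ‖((LinearMap.toMatrix' f).transpose * C * LinearMap.toMatrix' f) X Y‖ ≤ α)
    {ρ : ℝ} (hρ : 0 < ρ) (hθ : Real.exp 1 * α * normV Γ' κ ρ N / κ ^ 2 < 1)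
    {cr cc : ℝ} (hcr0 : 0 ≤ cr) (hcc0 : 0 ≤ cc)
    (hrow' : ∀ X'', ∑ X', ‖(LinearMap.toMatrix' g * LinearMap.toMatrix' f) X'' X'‖ ≤ cr)
    (hcol' : ∀ X', ∑ X'', ‖(LinearMap.toMatrix' g * LinearMap.toMatrix' f) X'' X'‖ ≤ cc)
    {ε : ℝ} (hε : 0 ≤ ε) {p : ℕ} (hp : 2 ≤ p) :
    IsUnit (effPartitionFn 𝕜 C (ExteriorAlgebra.map f Vt)) ∧
      kernelNorm ε (2 * p) (kernel 𝕜 (ExteriorAlgebra.map g (effAction 𝕜 C (ExteriorAlgebra.map f Vt))) (2 * p)) ≤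
        cr * cc ^ (2 * p - 1) * ε ^ (2 * p - 1) *
          (ρ⁻¹ ^ (2 * p) * (Real.exp 1 * ((Real.exp 2 * (κ + ρ)) ^ (2 * 2) * N 2)) *
            (Real.exp 1 * α * ((Real.exp 2 * (κ + ρ)) ^ (2 * 2) * N 2) / κ ^ 2) ^ (p - 2) /
              (1 - Real.exp 1 * α * normV Γ' κ ρ N / κ ^ 2) ^ p) := by
  set C' : Matrix Γ' Γ' 𝕜 := (LinearMap.toMatrix' f).transpose * C * LinearMap.toMatrix' f with hC'
  have hunit := (sum_norm_kernel_effAction_add_sum_cumulant_le_of_gramBounded C' hκ hGB Vt hVt hVt0 N hN0 hN hα hrow hcol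
    hρ hθ one_pos).1
  refine ⟨by rwa [effPartitionFn_map], ?_⟩
  have hbd := kernelNorm_kernel_effAction_le_biquartic_of_gramBounded C' hκ hGB Vt hVt hVt0 N hN0 hN hN2 hα hrow hcol hρ hθ hp
  rw [effAction_map, map_map_eq_map_comp]
  have hY := kernelNorm_kernel_map_le_of_pos (g ∘ₗ f) hcr0 hcc0
    (by intro X''; rw [LinearMap.toMatrix'_comp]; exact hrow' X'')
    (by intro X'; simp only [LinearMap.toMatrix'_comp]; exact hcol' X') hε (effAction 𝕜 C' Vt) (m := 2 * p) (by omega)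
  exact hY.trans (mul_le_mul_of_nonneg_left hbd (by positivity))

end Literature.MathematicalPhysics.QuantumLattice

end
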